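import Literature.ModelTheory.PseudofiniteFields.TriangularCharts

/-!
# Stub W6 of line LonelyTranslates (c1): triangular charts are standard smooth loci

Crux `PairwiseCurvedTilingsLC` (route DefinableSTPPDichotomy, stmt-MatrixMultiplication-17883),
negative line LonelyTranslates, continuation c1 ("Prop27Reduction").  The registered stub
`stub_chartSmoothDatum` is the field case of
`Literature/ModelTheory/PseudofiniteFields/TriangularCharts.lean`
(`SmoothDatum.exists_locus_eq_triangularChart`, valid over any domain): after a coordinate
equivalence `σ : Fin m ≃ Fin e ⊕ Fin k`, a chart cut out by triangular equations `D_j(u, w) = 0`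
(`∂D_j/∂w_i = 0` for `i < j`), a localisation `h ≠ 0` and the non-singularity conditions
`∂D_j/∂w_j ≠ 0` is the locus of the standard smooth datum `(D ∘ σ ; h ∘ σ ; cols j = σ⁻¹ (w_j))`,
whose Jacobian minor is `(∏_j ∂D_j/∂w_j) ∘ σ` by triangularity.  It is consumed by the chart
induction (`stub_openPiece`) of the skeleton.
-/

set_option linter.dupNamespace false  -- `Summit.<S>.<S>.…` is the mandated namespace

namespace Summit.MatrixMultiplication.MatrixMultiplication.Theorems.PairwiseCurvedTilingsLC.Negative

open FirstOrder FirstOrder.Language FirstOrder.Ring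
open Literature.ModelTheory.PseudofiniteFields

/-- STUB (helper W6): a triangular chart is a standard smooth locus (after a coordinate
equivalence `σ`): equations `D_j`, localisation `h`, distinguished columns the bound coordinates,
Jacobian minor `= ∏_j ∂D_j/∂w_j` by triangularity
(`SmoothDatum.exists_locus_eq_triangularChart`). -/
theorem stub_chartSmoothDatum {K : Type} [Field K] {m e k : ℕ} (σ : Fin m ≃ Fin e ⊕ Fin k)
    (D : Fin k → MvPolynomial (Fin e ⊕ Fin k) K) (h : MvPolynomial (Fin e ⊕ Fin k) K)
    (htri : ∀ j i : Fin k, i < j → MvPolynomial.pderiv (Sum.inr i) (D j) = 0) :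
    ∃ S : SmoothDatum K m k, S.locus =
      {x | (∀ j, MvPolynomial.eval (x ∘ σ.symm) (D j) = 0) ∧
        MvPolynomial.eval (x ∘ σ.symm) h ≠ 0 ∧
        ∀ j, MvPolynomial.eval (x ∘ σ.symm) (MvPolynomial.pderiv (Sum.inr j) (D j)) ≠ 0} :=
  SmoothDatum.exists_locus_eq_triangularChart σ D h htri

end Summit.MatrixMultiplication.MatrixMultiplication.Theorems.PairwiseCurvedTilingsLC.Negative
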